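import Mathlib
import HarnessLib
import Literature.NumberTheory.Automorphic.ArthurClozelWeakLiftingIsobaric
import Literature.NumberTheory.Automorphic.ArthurClozelWeakLiftingIsobaricAssembly
import Literature.NumberTheory.Automorphic.ArthurClozelBaseChangeAssembly
import Literature.NumberTheory.Automorphic.StrongMultiplicityOneLevel

/-!
# Stub `stub_weakLiftingGL2_of_liftDatum` of line Sketch (crux stmt-Langlands-16812
`ParityBlindBianchi.QuadraticBaseChangeGL2`) — Thm. 4.2 (a) in `L²` at rank `2` from the lift datum

Helper file (`--supports stmt-Langlands-16812`) of the crux "quadratic base change for `GL₂`".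
Clause (a) of the crux (a cuspidal weak base-change lift from an inert non-twist witness) is reduced
by the lead's skeleton to Arthur–Clozel 1989, Ch. 3, Thm. 4.2 (a) in the `L²` model at rank `2`,
the tree's named fact `ArthurClozel1989_weakLifting_cuspidal 2 F E` (`ArthurClozelBaseChange`).  The
tree proves that named fact in EVERY rank `n` from the trace-identity output `hI` (an isobaric
weak-lift datum over `E` for every cuspidal `π` on `GL_n(𝔸_F)`, every `n` and every Galois `E/F` of
prime degree), Jacquet–Shalika (2.2)–(2.3) and multiplicity one
(`arthurClozel1989_weakLifting_cuspidal_of_isobaricLiftFamilies'`,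
`ArthurClozelWeakLiftingIsobaricAssembly`); but its proof instantiates `hI` exactly once, at the
running rank and the running extension.  This file records the consequence the skeleton needs:

* `stub_weakLiftingGL2_of_liftDatum` — the registered stub: the `n = 2`, `[E:F] = 2` copy of that
  tree theorem, whose datum hypothesis `hI` is restricted to rank `2` and to quadratic `E/F`
  (`(Module.finrank F E).Prime → 0 < n →` replaced by `Module.finrank F E = 2 →`), the named facts
  `multiplicity_one_gl`, `JacquetShalika1981_partialPairL_boundary_of_ne_one`,
  `…_at_one_of_rank_ne`, `…_at_one_of_ne_conj`, `…_pole_of_eq_conj` entering as the all-rank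
  hypotheses `hm1`, `h22a`, `h22b`, `h22c`, `h23` (verbatim the shapes of the tree theorem).  Proof:
  verbatim the tree's `exists_cuspidal_weakLift_of_isobaricLiftFamilies` at `n := 2` (the
  `L`-function argument `card_le_one_of_isobaricWeakLift` leaves one member, of rank `2` and shift
  `0`, and `exists_cuspidal_weakLift_of_rank_eq` reads off Def. 1.1), then uniqueness and
  `σ`-stability by `arthurClozel1989_weakLifting_cuspidal_of_exists` with strong multiplicity one
  over `E` supplied by `strong_multiplicity_one_gl_forall_of_jacquetShalika hm1 h22c h23`.

No definitions, no named facts.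
-/

noncomputable section

open scoped BigOperators Topology Classical Matrix NumberField MatrixGroups
open Literature.NumberTheory.Automorphic Literature.NumberTheory.GaloisRepresentations
  IsDedekindDomain NumberField Filter MeasureTheory
open Literature.NumberTheory.Automorphic.AdelicGroupData

-- `Summit.Langlands.Langlands.…`: summit = sub-problem name (D-0017 nested layout), not a typo.
set_option linter.dupNamespace false

namespace Summit.Langlands.Langlands.Theorems.QuadraticBaseChangeGL2

/-! ### The stub -/

/-- **Stub `stub_weakLiftingGL2_of_liftDatum` (Arthur–Clozel Ch. 3 Thm. 4.2 (a) in `L²` at rank `2`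
for quadratic `E/F`, from the lift datum and the named facts).**  Hypotheses. `hI`: the isobaric
weak-lift datum at `n = 2 = [E:F]` — for `E/F` Galois quadratic, `π` cuspidal in
`L²_cusp(GL₂(𝔸_F) ⧸ A_G GL₂(F), μ)` and any family `ν_a` of automorphic measures over `E`, finitely
many cuspidal `Πₘ` on `GL_{dₘ}(𝔸_E)`, `dₘ ≥ 1`, `∑ dₘ = 2`, shifts `sₘ` with `∑ dₘ sₘ = 0`, a finite
`S`, Satake families `α` of `π` off `S` and `Aₘ` of `Πₘ` off `S_E`, with
`α(v)^{f(w|v)} = ∑ₘ q_w^{-sₘ} Aₘ(w)` for `w ∣ v ∉ S` (the first two steps of the printed proof of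
(a), pp. 203–204, at `n = 2`; Jacquet 1972 Thm. 20.6 in print).  `hm1`, `h22a`, `h22b`, `h22c`,
`h23`: multiplicity one on `L²_cusp(GL_n)` and Jacquet–Shalika (2.2) (three renderings) and (2.3),
all ranks and all number fields.  Conclusion: `ArthurClozel1989_weakLifting_cuspidal 2 F E` for
every `E/F` with `[E:F] = 2`.  Proof: the `n = 2` copy of
`exists_cuspidal_weakLift_of_isobaricLiftFamilies` — automorphic measures `νE a` on all the
`GL_a(𝔸_E) ⧸ A_G GL_a(E)` (`exists_isAutomorphicMeasure_gl_holds`), the datum `hI` at `(μ, π, νE)`,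
an index `m₀` minimising `re sₘ`, a level `𝔪` of `η` (`HeckeCharacter.exists_level_of_isFiniteOrder`),
the finite set of places in `S₀`, dividing `𝔪` or ramified in `E`; the `L`-function argument
`card_le_one_of_isobaricWeakLift` (pp. 204–205) leaves one member, so `d_{m₀} = 2`, `s_{m₀} = 0` and
the datum relation is Def. 1.1 for `(π, Π_{m₀})` (`exists_cuspidal_weakLift_of_rank_eq`); then
uniqueness ("obvious by (2.4)") and `σ`-stability by `arthurClozel1989_weakLifting_cuspidal_of_exists`,
strong multiplicity one over `E` being `strong_multiplicity_one_gl_forall_of_jacquetShalika hm1 h22c h23`.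
[cite: ArthurClozelAMS120, Ch. 3, Thm. 4.2 (a) and its proof, pp. 203–205] -/
theorem stub_weakLiftingGL2_of_liftDatum
    (hI : ∀ {F E : Type} [Field F] [NumberField F] [Field E] [NumberField E] [Algebra F E] [IsGalois F E], Module.finrank F E = 2 → ∀ (μ : Measure (gl 2 F).automorphicQuotient) [(gl 2 F).IsAutomorphicMeasure μ] (P : CuspidalAutomorphicRepGL 2 F μ) (ν : (a : ℕ) → Measure (gl a E).automorphicQuotient) [∀ a, (gl a E).IsAutomorphicMeasure (ν a)], ∃ (M : Type) (_ : Fintype M) (d : M → ℕ) (Q : ∀ m, CuspidalAutomorphicRepGL (d m) E (ν (d m))) (s : M → ℂ) (S : Set (HeightOneSpectrum (𝓞 F))) (α : SatakeFamily F) (A : M → SatakeFamily E), (∀ m, 0 < d m) ∧ ∑ m, d m = 2 ∧ ∑ m, (d m : ℂ) * s m = 0 ∧ S.Finite ∧ IsSatakeFamilyOf P S α ∧ (∀ m, IsSatakeFamilyOf (Q m) {w | w.under (𝓞 F) ∈ S} (A m)) ∧ ∀ w : HeightOneSpectrum (𝓞 E), w.under (𝓞 F) ∉ S → (α (w.under (𝓞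 F))).map (· ^ w.asIdeal.inertiaDeg (𝓞 F)) = ∑ m, (A m w).map (((w.residueCard : ℂ) ^ (-(s m))) * ·))
    (hm1 : ∀ (n : ℕ) (K : Type) [Field K] [NumberField K] (μ : Measure (gl n K).automorphicQuotient)
      [(gl n K).IsAutomorphicMeasure μ], multiplicity_one_gl n K μ)
    (h22a : ∀ (n m : ℕ) (K : Type) [Field K] [NumberField K] (μ : Measure (gl n K).automorphicQuotient)
      [(gl n K).IsAutomorphicMeasure μ] (μ' : Measure (gl m K).automorphicQuotient)
      [(gl m K).IsAutomorphicMeasure μ'],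
      JacquetShalika1981_partialPairL_boundary_of_ne_one (n := n) (m := m) (K := K) (μ := μ) (μ' := μ'))
    (h22b : ∀ (n m : ℕ) (K : Type) [Field K] [NumberField K] (μ : Measure (gl n K).automorphicQuotient)
      [(gl n K).IsAutomorphicMeasure μ] (μ' : Measure (gl m K).automorphicQuotient)
      [(gl m K).IsAutomorphicMeasure μ'],
      JacquetShalika1981_partialPairL_at_one_of_rank_ne (n := n) (m := m) (K := K) (μ := μ) (μ' := μ'))
    (h22c : ∀ (n : ℕ) (K : Type) [Field K] [NumberField K] (μ : Measure (gl n K).automorphicQuotient)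
      [(gl n K).IsAutomorphicMeasure μ],
      JacquetShalika1981_partialPairL_at_one_of_ne_conj (n := n) (K := K) (μ := μ))
    (h23 : ∀ (n : ℕ) (K : Type) [Field K] [NumberField K] (μ : Measure (gl n K).automorphicQuotient)
      [(gl n K).IsAutomorphicMeasure μ],
      JacquetShalika1981_partialPairL_pole_of_eq_conj (n := n) (K := K) (μ := μ)) :
    ∀ (F E : Type) [Field F] [NumberField F] [Field E] [NumberField E] [Algebra F E]
      [FiniteDimensional F E], Module.finrank F E = 2 → ArthurClozel1989_weakLifting_cuspidal 2 F E := by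
  intro F E _ _ _ _ _ _ h2
  -- uniqueness and `σ`-stability "by (2.4)": strong multiplicity one over `E` from (2.2)–(2.3) and
  -- multiplicity one (`strong_multiplicity_one_gl_forall_of_jacquetShalika`)
  refine arthurClozel1989_weakLifting_cuspidal_of_exists ?_
    fun ν _ => strong_multiplicity_one_gl_forall_of_jacquetShalika hm1 h22c h23 2 E ν
  -- adapted from Literature/NumberTheory/Automorphic/ArthurClozelWeakLiftingIsobaric.lean
  -- (exists_cuspidal_weakLift_of_isobaricLiftFamilies), at `n := 2`, `[E:F] = 2`
  intro _ hn hℓ η hη μ _ hmF P hP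
  classical
  -- automorphic measures on all the `GL_a(𝔸_E) ⧸ A_G GL_a(E)`
  choose νE hνE using fun a => AdelicGroupData.exists_isAutomorphicMeasure_gl_holds a E
  haveI : ∀ a, (gl a E).IsAutomorphicMeasure (νE a) := hνE
  -- the lift datum: an isobaric weak-lift datum for `π` over `E`, at rank `2`
  obtain ⟨M, _, d, Q, s, S₀, α, A, hd, hdn, hds, hS₀, hα, hA, hrel⟩ := hI h2 μ P νE
  -- an index minimising `re sₘ`
  have hMne : (Finset.univ : Finset M).Nonempty := by
    by_contra h
    rw [Finset.not_nonempty_iff_eq_empty, Finset.univ_eq_empty_iff] at h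
    have h0 : ∑ m, d m = 0 := Finset.sum_eq_zero fun m _ => (IsEmpty.false m).elim
    omega
  obtain ⟨m₀, -, hm₀⟩ := Finset.exists_min_image Finset.univ (fun m => (s m).re) hMne
  have hm₀' : ∀ m, (s m₀).re ≤ (s m).re := fun m => hm₀ m (Finset.mem_univ m)
  -- a level of `η`; the exceptional places: a finite set `S ⊇ S₀`
  obtain ⟨𝔪, h𝔪, hη𝔪⟩ := HeckeCharacter.exists_level_of_isFiniteOrder 2 hη.isFiniteOrder
  have h𝔪fin : {v : HeightOneSpectrum (𝓞 F) | v.asIdeal ∣ 𝔪}.Finite := Ideal.finite_factors h𝔪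
  have hunrfin : {v : HeightOneSpectrum (𝓞 F) | ¬ Algebra.IsUnramifiedIn (𝓞 E) v.asIdeal}.Finite :=
    finite_setOf_not_isUnramifiedIn F E
  set S : Set (HeightOneSpectrum (𝓞 F)) :=
    (S₀ ∪ {v | v.asIdeal ∣ 𝔪}) ∪ {v | ¬ Algebra.IsUnramifiedIn (𝓞 E) v.asIdeal} with hSdef
  have hS : S.Finite := (hS₀.union h𝔪fin).union hunrfin
  have hmemS : ∀ v, v ∈ S ↔ (v ∈ S₀ ∨ v.asIdeal ∣ 𝔪) ∨
      ¬ Algebra.IsUnramifiedIn (𝓞 E) v.asIdeal := fun v => by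
    simp only [hSdef, Set.mem_union, Set.mem_setOf_eq]
  have hS₀S : S₀ ⊆ S := fun v hv => (hmemS v).mpr (Or.inl (Or.inl hv))
  have h𝔪S : ∀ v ∉ S, ¬ v.asIdeal ∣ 𝔪 := fun v hv h => hv ((hmemS v).mpr (Or.inl (Or.inr h)))
  have hunrS : ∀ v ∉ S, Algebra.IsUnramifiedIn (𝓞 E) v.asIdeal := fun v hv =>
    by_contra fun h => hv ((hmemS v).mpr (Or.inr h))
  have hSE₀ : {w : HeightOneSpectrum (𝓞 E) | w.under (𝓞 F) ∈ S₀} ⊆ {w | w.under (𝓞 F) ∈ S} :=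
    fun w hw => hS₀S hw
  -- the `L`-function argument (pp. 204–205): one member
  have hcard : Fintype.card M ≤ 1 :=
    card_le_one_of_isobaricWeakLift hℓ νE (fun a b => h22a a b E (νE a) (νE b))
      (fun a b => h22b a b E (νE a) (νE b)) (fun a => h22c a E (νE a)) (fun a => h23 a E (νE a))
      (fun a => hm1 a E (νE a)) (h22a 2 2 F μ μ) (h22c 2 F μ) (h23 2 F μ) hmF hn P hη hP h𝔪 hη𝔪
      hS h𝔪S hunrS (hα.mono hS₀S) d hd Q s m₀ hm₀' hds (fun m => (hA m).mono hSE₀)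
      (fun w hw => hrel w fun h => hw (hS₀S h))
  have huniq : ∀ m, m = m₀ := fun m => Fintype.card_le_one_iff.mp hcard m m₀
  have hsum1 : ∀ {N : Type} [AddCommMonoid N] (f : M → N), ∑ m, f m = f m₀ := fun f =>
    Finset.sum_eq_single m₀ (fun m _ hne => absurd (huniq m) hne)
      fun h => absurd (Finset.mem_univ m₀) h
  -- the one member has rank `2` and shift `0`: Def. 1.1 for `(π, Π_{m₀})`
  have hdm₀ : d m₀ = 2 := by
    rw [hsum1] at hdn
    exact hdn
  have hs0 : s m₀ = 0 := by
    rw [hsum1] at hds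
    exact (mul_eq_zero.mp hds).resolve_left (Nat.cast_ne_zero.mpr (hd m₀).ne')
  refine exists_cuspidal_weakLift_of_rank_eq hdm₀ P (Q m₀) hS₀ hα (hA m₀) fun w hw => ?_
  rw [hrel w hw, hsum1, hs0, neg_zero, Complex.cpow_zero]
  simp only [one_mul, Multiset.map_id']

end Summit.Langlands.Langlands.Theorems.QuadraticBaseChangeGL2

end
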